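import Literature.MathematicalPhysics.KineticTheory.HardSphereWindowPressureStatic
import Literature.MathematicalPhysics.KineticTheory.HardSphereDisplacementPathLength
import Summits.AtomisticToContinuum.HydrodynamicLimit.Theorems.AntiMazurCoboundariesInfluenceLocalityTrueCapsExistPrelimA
import Summits.AtomisticToContinuum.HydrodynamicLimit.Theorems.JParityClosureOddContactSymmetryGibbsInvariance

/-!
# Pathwise count of disturbed spheres from the tube count

Route `AntiMazurCoboundaries` of `AtomisticToContinuum/HydrodynamicLimit`, crux stmt-AtomisticToContinuum-14135
(`CorrectorPressureDecay`), line `almost-invariant-duality`, lead-held layer-2 input h₂ = within-lag SHOT-NOISE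
PRESSURE (hypothesis `h₂` of `TransferSkeleton.correctorPressureDecay_of_inputs`); registered sub-goal
`snp_kinematics_of_tubeCount`.

Along a good orbit of `N` hard spheres of diameter `ε` on `𝕋³`, over a horizon `[0, L]`, write
`d_i := ∫₀ᴸ ‖v_i(t)‖ dt` for the path length of sphere `i` and fix a tameness radius `0 < r ≤ ε`.
We prove the deterministic core of the within-lag shot-noise pressure bound: the number of spheres that
have changed velocity by a time `u ∈ [0, L]` or have wandered (`d_i > r`) is at most the number of
static close pairs at time `0` (some other sphere within `ε + 2r`) plus, for every wanderer `j`, the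
slack `2` and the tube count `1331 (d_j / ε + 1)` of hypothesis `htube` (the number of tame spheres that
touch `j` during `[0, L]`).

Proof. Let `B` be the counted set, `W := {j | r < d_j}` the wanderers, `S` the static close-pair set
and `T j` the tube set of `j`. Then `B ⊆ S ∪ W ∪ ⋃_{j ∈ W} T j`: a sphere `i ∈ B` that is not a
wanderer has `d_i ≤ r` and a changed velocity at time `u`; by the flight-start alternative
(`TrueCaps.exists_flightStart`) its velocity at time `u` is the one acquired at a time `r' ∈ [0, u]`
which is either `0` — impossible, the velocity changed — or a contact time of `i` with some sphere
`k ≠ i`. If `k` wanders, `i ∈ T k`; otherwise `d_k ≤ r` and, displacements being bounded by path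
lengths (`HardSphereFlow.euclidDist_flow_le_integral_norm_vel_of_mem_Icc`), the triangle inequality
gives `dist(x_i(0), x_k(0)) ≤ d_i + ε + d_k ≤ ε + 2r`, so `i ∈ S`. Counting,
`#B ≤ #S + #W + ∑_{j ∈ W} #(T j) ≤ #S + ∑_{j ∈ W} (2 + 1331 (d_j / ε + 1))` by `htube`.
-/

noncomputable section

open MeasureTheory Set Filter Topology
open scoped ENNReal Classical

namespace Summit.AtomisticToContinuum.HydrodynamicLimit.Theorems.ShotNoisePressure

open Literature.Analysis.FluidPDE
open Literature.MathematicalPhysics.KineticTheory (T3 V3 hsDiameter localGibbsLaw gaussMeasure)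

/-- Counting step: if `B ⊆ S ∪ W ∪ ⋃_{j ∈ W} T j` with `W = {j | p j}` and `#(T j) ≤ g j` on `W`, then
`#B ≤ #S + ∑_j [p j] (2 + g j)` (union bound, `Finset.card_biUnion_le`; the extra `1` per wanderer is
slack). [folklore] -/
theorem snp_card_le_of_subset_tubes {α : Type*} [Fintype α] [DecidableEq α] (B S : Finset α)
    (p : α → Prop) [DecidablePred p] (T : α → Finset α) (g : α → ℝ)
    (hsub : B ⊆ S ∪ ((Finset.univ.filter p) ∪ (Finset.univ.filter p).biUnion T))
    (hT : ∀ j, p j → ((T j).card : ℝ) ≤ g j) :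
    (B.card : ℝ) ≤ (S.card : ℝ) + ∑ j, (if p j then 2 + g j else 0) := by
  set W : Finset α := Finset.univ.filter p with hW
  have h1 : B.card ≤ S.card + (W.card + ∑ j ∈ W, (T j).card) :=
    calc B.card ≤ (S ∪ (W ∪ W.biUnion T)).card := Finset.card_le_card hsub
      _ ≤ S.card + (W ∪ W.biUnion T).card := Finset.card_union_le _ _
      _ ≤ S.card + (W.card + (W.biUnion T).card) :=
          Nat.add_le_add_left (Finset.card_union_le _ _) _
      _ ≤ S.card + (W.card + ∑ j ∈ W, (T j).card) :=
          Nat.add_le_add_left (Nat.add_le_add_left Finset.card_biUnion_le _) _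
  have h2 : (B.card : ℝ) ≤ (S.card : ℝ) + ((W.card : ℝ) + ∑ j ∈ W, ((T j).card : ℝ)) := by
    exact_mod_cast h1
  have h3 : ∀ j ∈ W, (1 : ℝ) + ((T j).card : ℝ) ≤ 2 + g j := fun j hj => by
    have := hT j (Finset.mem_filter.1 hj).2
    linarith
  have h4 : ∑ j ∈ W, ((1 : ℝ) + ((T j).card : ℝ)) ≤ ∑ j ∈ W, (2 + g j) := Finset.sum_le_sum h3
  rw [Finset.sum_add_distrib, Finset.sum_const, nsmul_eq_mul, mul_one] at h4
  have h5 : (∑ j, (if p j then 2 + g j else 0)) = ∑ j ∈ W, (2 + g j) :=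
    (Finset.sum_filter p fun j => 2 + g j).symm
  rw [h5]
  linarith

/-- **Pathwise count from the tube count** (`snp_kinematics` with the tube count as hypothesis): along a
good orbit, the spheres whose velocity at time `u ∈ [0, L]` differs from the initial one, or whose path
length over `[0, L]` exceeds `r` (`0 < r ≤ ε`), are at most the static close pairs at time `0` (another
sphere within `ε + 2r`) plus `2 + 1331 (d_j / ε + 1)` per wanderer `j` (flight-start alternative,
displacement `≤` path length, triangle inequality, union bound). [folklore] -/
theorem snp_kinematics_of_tubeCount : ∀ (htube : ∀ {N : ℕ} {ε : ℝ}, 0 < ε → ∀ (Φ : HardSphereFlow (Torus.geometry (Fin 3)) ε N)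
      {z : Config N (Fin 3) T3}, z ∈ Φ.good → ∀ {L r : ℝ}, 0 ≤ L → 0 < r → r ≤ ε → ∀ j : Fin N,
      ((Finset.univ.filter fun i : Fin N => i ≠ j ∧ (∫ t in (0 : ℝ)..L, ‖(Φ.flow t z i).2‖) ≤ r ∧
          ∃ t ∈ Icc 0 L, ‖(Torus.geometry (Fin 3)).sepVec (Φ.flow t z i).1 (Φ.flow t z j).1‖ = ε).card : ℝ) ≤
        1331 * ((∫ t in (0 : ℝ)..L, ‖(Φ.flow t z j).2‖) / ε + 1))
    {N : ℕ} {ε : ℝ} (hε : 0 < ε)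
    (Φ : HardSphereFlow (Torus.geometry (Fin 3)) ε N) {z : Config N (Fin 3) T3} (hz : z ∈ Φ.good)
    {L r : ℝ} (hL : 0 ≤ L) (hr : 0 < r) (hrε : r ≤ ε) {u : ℝ} (hu : u ∈ Icc 0 L),
    ((Finset.univ.filter fun i : Fin N =>
        (Φ.flow u z i).2 ≠ (z i).2 ∨ r < ∫ t in (0 : ℝ)..L, ‖(Φ.flow t z i).2‖).card : ℝ) ≤
      ((Finset.univ.filter fun i : Fin N =>
          ∃ j : Fin N, j ≠ i ∧ Torus.euclidDist (z i).1 (z j).1 ≤ ε + 2 * r).card : ℝ) +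
        ∑ j : Fin N, (if r < ∫ t in (0 : ℝ)..L, ‖(Φ.flow t z j).2‖ then
          2 + 1331 * ((∫ t in (0 : ℝ)..L, ‖(Φ.flow t z j).2‖) / ε + 1) else 0) := by
  intro htube N ε hε Φ z hz L r hL hr hrε u hu
  refine snp_card_le_of_subset_tubes _ _
    (fun j : Fin N => r < ∫ t in (0 : ℝ)..L, ‖(Φ.flow t z j).2‖)
    (fun j : Fin N => Finset.univ.filter fun i : Fin N =>
      i ≠ j ∧ (∫ t in (0 : ℝ)..L, ‖(Φ.flow t z i).2‖) ≤ r ∧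
        ∃ t ∈ Icc 0 L, ‖(Torus.geometry (Fin 3)).sepVec (Φ.flow t z i).1 (Φ.flow t z j).1‖ = ε)
    (fun j : Fin N => 1331 * ((∫ t in (0 : ℝ)..L, ‖(Φ.flow t z j).2‖) / ε + 1)) ?_
    (fun j _ => htube hε Φ hz hL hr hrε j)
  -- the inclusion `B ⊆ S ∪ W ∪ ⋃_{j ∈ W} T j`
  intro i hi
  have hi' := (Finset.mem_filter.1 hi).2
  refine Finset.mem_union.2 ?_
  by_cases hdi : r < ∫ t in (0 : ℝ)..L, ‖(Φ.flow t z i).2‖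
  · -- `i` wanders
    exact Or.inr (Finset.mem_union.2 (Or.inl (Finset.mem_filter.2 ⟨Finset.mem_univ _, hdi⟩)))
  have hvel : (Φ.flow u z i).2 ≠ (z i).2 := hi'.resolve_right hdi
  have hdi' : (∫ t in (0 : ℝ)..L, ‖(Φ.flow t z i).2‖) ≤ r := not_lt.1 hdi
  -- the flight-start alternative for sphere `i` at time `u`
  obtain ⟨r', hr'u, hveq, -, halt⟩ :=
    TrueAnchoredInfection.TrueCaps.exists_flightStart (Φ.isTrajectory z hz) i hu.1
  rcases halt with rfl | ⟨-, k, hik, hcontact⟩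
  · -- `r' = 0`: the velocity did not change, contradiction
    have h0 : (Φ.flow 0 z i).2 = (z i).2 := by rw [Φ.flow_zero z hz]
    exact absurd (hveq.trans h0) hvel
  have hr'L : r' ∈ Icc 0 L := ⟨hr'u.1, hr'u.2.trans hu.2⟩
  by_cases hdk : r < ∫ t in (0 : ℝ)..L, ‖(Φ.flow t z k).2‖
  · -- `k` wanders and `i` lies in its tube
    refine Or.inr (Finset.mem_union.2 (Or.inr (Finset.mem_biUnion.2
      ⟨k, Finset.mem_filter.2 ⟨Finset.mem_univ _, hdk⟩, ?_⟩)))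
    exact Finset.mem_filter.2 ⟨Finset.mem_univ _, hik, hdi', r', hr'L, hcontact⟩
  · -- both spheres are tame: a static close pair at time `0`
    have hdk' : (∫ t in (0 : ℝ)..L, ‖(Φ.flow t z k).2‖) ≤ r := not_lt.1 hdk
    refine Or.inl (Finset.mem_filter.2 ⟨Finset.mem_univ _, k, hik.symm, ?_⟩)
    have h1 : Torus.euclidDist (z i).1 (Φ.flow r' z i).1 ≤ ∫ t in (0 : ℝ)..L, ‖(Φ.flow t z i).2‖ := by
      have h := Φ.euclidDist_flow_le_integral_norm_vel_of_mem_Icc hz i hr'L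
      rw [Φ.flow_zero z hz, Torus.euclidDist_comm] at h
      exact h
    have h2 : Torus.euclidDist (Φ.flow r' z i).1 (Φ.flow r' z k).1 = ε := by
      rw [← Torus.norm_geometry_sepVec]
      exact hcontact
    have h3 : Torus.euclidDist (Φ.flow r' z k).1 (z k).1 ≤ ∫ t in (0 : ℝ)..L, ‖(Φ.flow t z k).2‖ := by
      have h := Φ.euclidDist_flow_le_integral_norm_vel_of_mem_Icc hz k hr'L
      rw [Φ.flow_zero z hz] at h
      exact h
    calc Torus.euclidDist (z i).1 (z k).1
        ≤ Torus.euclidDist (z i).1 (Φ.flow r' z i).1 + Torus.euclidDist (Φ.flow r' z i).1 (z k).1 :=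
          Literature.MathematicalPhysics.KineticTheory.euclidDist_triangle _ _ _
      _ ≤ Torus.euclidDist (z i).1 (Φ.flow r' z i).1 +
            (Torus.euclidDist (Φ.flow r' z i).1 (Φ.flow r' z k).1 +
              Torus.euclidDist (Φ.flow r' z k).1 (z k).1) :=
          add_le_add le_rfl (Literature.MathematicalPhysics.KineticTheory.euclidDist_triangle _ _ _)
      _ ≤ r + (ε + r) := add_le_add (h1.trans hdi') (add_le_add h2.le (h3.trans hdk'))
      _ = ε + 2 * r := by ring

end Summit.AtomisticToContinuum.HydrodynamicLimit.Theorems.ShotNoisePressure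

end
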